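import Summits.QuantumFields.YangMills.Theorems.IsotropyFromPowerCountingTemperedCurvatureMomentsShieldedTame

/-!
# CH_n along a subsequence: reindexed schemes, monotonicity in the stub, and the frequently-tame sector

Support file of the line `Sketch` (card `markov-shielding`) of crux `TemperedCurvatureMoments` (T, stmt-QuantumFields-17721),
reshape 2 of the registered skeleton `Cruxes/TemperedCurvatureMoments/Lines/Sketch.lean` (lead c1).  The skeleton's
Yang–Mills stub is now D' = `stub_shieldedMomentBoundSubseq`: the shielded moment bound CH_n holds ALONG SOME strictly
monotone subsequence `φ` of the scheme (for every physical radius `ρ ∈ (0,1]`, eventually in `k`, at every site of the inner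
half-box of step `φ k`, the `Lⁿ(μ_{φ k})` law of `E[c(F∘τ_y − m) | links based outside the sup-cube of radius ⌊ρ/a⌋ around y]`
at step `φ k` is `≤ C ρ^{-p}`).  This file certifies, over the tree as it is:

* `tie_reindex` — the Wilson tie passes to the REINDEXED scheme `sch ∘ φ` (its lattice `n`-point functions at step `k` are
  those of `sch` at step `φ k`, definitionally);
* `shieldedMomentBoundSubseq_of_shieldedMomentBound` — D ⇒ D' (`φ = id`): the reshaped stub is implied by reshape 1's
  k-uniform stub `stub_shieldedMomentBound`;
* `shieldedMomentBoundSubseq_of_frequently_bddRenormalisation` — **D' on the frequently-tame sector**: if the scheme is tied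
  to `S₁` and `|c_k| ≤ B` FREQUENTLY (along some subsequence), then D' holds at `(r, sch)` for every `n > 0` (extract the
  tame subsequence, `Filter.extraction_of_frequently_atTop`; the reindexed scheme is tied and has bounded renormalisation,
  so the landed `shieldedMomentBound_of_bddRenormalisation` (p146561) applies to it).  The k-uniform D is NOT certified
  there (nothing controls the wild steps of a frequently-tame scheme): D' is strictly easier to inhabit;
* `tendsto_abs_c_of_not_shieldedMomentBoundSubseq` — contrapositive: an obstruction to D' at a tied scheme forces
  `|c_k| → ∞` — the residual content of D' lives on schemes with DIVERGENT multiplicative renormalisation (the physical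
  regime `c_k ≍ a_k⁻⁴`), where it is the UV power counting of `tr F²` in one-point form (`p = 4` expected).

References: Osterwalder–Seiler 1978 §2; Friedli–Velenik 2017 §6.3. [folklore]
-/

noncomputable section

namespace Summit.QuantumFields.YangMills.Theorems.TemperedCurvatureMoments.Sketch

open scoped BigOperators
open MeasureTheory Filter Topology
open Literature.MathematicalPhysics.QuantumFieldTheory Literature.MathematicalPhysics.QuantumLattice
open Literature.MathematicalPhysics.AQFT
open Literature.Probability.LatticeModels (box Site)
open Summit.QuantumFields.YangMills.Theorems.CurvatureBoostCovariance.Negative (Tie)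
open Summit.QuantumFields.YangMills.Theorems.NPointIsotropy.Negative (E4)

variable {G : Type} [Group G] [TopologicalSpace G] [IsTopologicalGroup G] [CompactSpace G]
  [MeasurableSpace G] [BorelSpace G]

/-- **The tie passes to subsequences**: a family tied to `sch` is tied to the reindexed scheme `sch ∘ φ` for every
strictly monotone `φ` (the lattice `n`-point functions of the reindexed scheme at step `k` ARE those of `sch` at step
`φ k`, definitionally). [folklore] -/
theorem tie_reindex (r : LatticeRep G) (sch : SpeciesScheme (YMSpecies G)) (S₁ : SchwingerFamily E4)
    (htie : Tie r sch S₁) {φ : ℕ → ℕ} (hφ : StrictMono φ) :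
    Tie r
      { a := sch.a ∘ φ, a_pos := fun k => sch.a_pos (φ k), tendsto_a := sch.tendsto_a.comp hφ.tendsto_atTop,
        β := sch.β ∘ φ, L := sch.L ∘ φ, tendsto_L := sch.tendsto_L.comp hφ.tendsto_atTop,
        c := fun s => sch.c s ∘ φ, m := fun s => sch.m s ∘ φ } S₁ :=
  fun n hn f F hF hF' => (htie n hn f F hF hF').comp hφ.tendsto_atTop

/-- **D ⇒ D'** (`φ = id`): the k-uniform shielded moment bound of reshape 1 (`stub_shieldedMomentBound` at `(r, sch, n)`)
implies the subsequence form of reshape 2 (`stub_shieldedMomentBoundSubseq` at `(r, sch, n)`). [folklore] -/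
theorem shieldedMomentBoundSubseq_of_shieldedMomentBound (r : LatticeRep G) (sch : SpeciesScheme (YMSpecies G))
    {n : ℕ}
    (h : ∃ (C p : ℝ), 0 < C ∧ ∀ ρ : ℝ, 0 < ρ → ρ ≤ 1 → ∃ k₀ : ℕ, ∀ k : ℕ, k₀ ≤ k →
      ∀ y : Site 4, y ∈ box 4 (sch.L k / 2) →
        (∫ U, |((wilsonMeasure r.ρ (sch.β k) : Measure (GaugeConfig 4 (2 * sch.L k + 1) G))[(fun U =>
            sch.c r.curvature k *
              (r.curvature.F (configShift (-y) (torusLift (2 * sch.L k + 1) U)) - sch.m r.curvature k)) |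
            cylinderEvents {ℓ : Edge 4 (2 * sch.L k + 1) | ¬ ∀ ν : Fin 4,
              (ℓ.1 ν - ((y ν : ℤ) : ZMod (2 * sch.L k + 1)) +
                ((⌊ρ / sch.a k⌋₊ : ℕ) : ZMod (2 * sch.L k + 1))).val ≤ 2 * ⌊ρ / sch.a k⌋₊}]) U| ^ n
          ∂(wilsonMeasure r.ρ (sch.β k) : Measure (GaugeConfig 4 (2 * sch.L k + 1) G))) ^ ((n : ℝ)⁻¹) ≤
          C * ρ ^ (-p)) :
    ∃ φ : ℕ → ℕ, StrictMono φ ∧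
      ∃ (C p : ℝ), 0 < C ∧ ∀ ρ : ℝ, 0 < ρ → ρ ≤ 1 → ∃ k₀ : ℕ, ∀ k : ℕ, k₀ ≤ k →
        ∀ y : Site 4, y ∈ box 4 (sch.L (φ k) / 2) →
          (∫ U, |((wilsonMeasure r.ρ (sch.β (φ k)) :
              Measure (GaugeConfig 4 (2 * sch.L (φ k) + 1) G))[(fun U =>
              sch.c r.curvature (φ k) *
                (r.curvature.F (configShift (-y) (torusLift (2 * sch.L (φ k) + 1) U)) -
                  sch.m r.curvature (φ k))) |
              cylinderEvents {ℓ : Edge 4 (2 * sch.L (φ k) + 1) | ¬ ∀ ν : Fin 4,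
                (ℓ.1 ν - ((y ν : ℤ) : ZMod (2 * sch.L (φ k) + 1)) +
                  ((⌊ρ / sch.a (φ k)⌋₊ : ℕ) : ZMod (2 * sch.L (φ k) + 1))).val ≤
                    2 * ⌊ρ / sch.a (φ k)⌋₊}]) U| ^ n
            ∂(wilsonMeasure r.ρ (sch.β (φ k)) : Measure (GaugeConfig 4 (2 * sch.L (φ k) + 1) G))) ^
              ((n : ℝ)⁻¹) ≤ C * ρ ^ (-p) :=
  ⟨id, strictMono_id, h⟩

/-- **D' ON THE FREQUENTLY-TAME SECTOR.**  For a scheme tied to `S₁` (only the degree-one tie is used) whose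
multiplicative renormalisation of the curvature species is bounded FREQUENTLY, `∃ B, ∃ᶠ k, |c_k| ≤ B`, the subsequence
form D' of the shielded moment bound holds at `(r, sch)` for every `n > 0`: along a strictly monotone `φ` with
`|c_{φ k}| ≤ B` the reindexed scheme `sch ∘ φ` is tied (`tie_reindex`) with bounded renormalisation, so the tame-sector
bound `shieldedMomentBound_of_bddRenormalisation` (with `p = 0`) applies to it — and CH_n for `sch ∘ φ` at step `k` is
CH_n for `sch` at step `φ k`. [folklore] -/
theorem shieldedMomentBoundSubseq_of_frequently_bddRenormalisation (r : LatticeRep G)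
    (sch : SpeciesScheme (YMSpecies G)) (S₁ : SchwingerFamily E4) (htie : Tie r sch S₁)
    (hB : ∃ B : ℝ, ∃ᶠ k in atTop, |sch.c r.curvature k| ≤ B) {n : ℕ} (hn : 0 < n) :
    ∃ φ : ℕ → ℕ, StrictMono φ ∧
      ∃ (C p : ℝ), 0 < C ∧ ∀ ρ : ℝ, 0 < ρ → ρ ≤ 1 → ∃ k₀ : ℕ, ∀ k : ℕ, k₀ ≤ k →
        ∀ y : Site 4, y ∈ box 4 (sch.L (φ k) / 2) →
          (∫ U, |((wilsonMeasure r.ρ (sch.β (φ k)) :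
              Measure (GaugeConfig 4 (2 * sch.L (φ k) + 1) G))[(fun U =>
              sch.c r.curvature (φ k) *
                (r.curvature.F (configShift (-y) (torusLift (2 * sch.L (φ k) + 1) U)) -
                  sch.m r.curvature (φ k))) |
              cylinderEvents {ℓ : Edge 4 (2 * sch.L (φ k) + 1) | ¬ ∀ ν : Fin 4,
                (ℓ.1 ν - ((y ν : ℤ) : ZMod (2 * sch.L (φ k) + 1)) +
                  ((⌊ρ / sch.a (φ k)⌋₊ : ℕ) : ZMod (2 * sch.L (φ k) + 1))).val ≤
                    2 * ⌊ρ / sch.a (φ k)⌋₊}]) U| ^ n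
            ∂(wilsonMeasure r.ρ (sch.β (φ k)) : Measure (GaugeConfig 4 (2 * sch.L (φ k) + 1) G))) ^
              ((n : ℝ)⁻¹) ≤ C * ρ ^ (-p) := by
  obtain ⟨B, hB⟩ := hB
  obtain ⟨φ, hφ, hφB⟩ := extraction_of_frequently_atTop hB
  refine ⟨φ, hφ, ?_⟩
  exact shieldedMomentBound_of_bddRenormalisation r
    { a := sch.a ∘ φ, a_pos := fun k => sch.a_pos (φ k), tendsto_a := sch.tendsto_a.comp hφ.tendsto_atTop,
      β := sch.β ∘ φ, L := sch.L ∘ φ, tendsto_L := sch.tendsto_L.comp hφ.tendsto_atTop,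
      c := fun s => sch.c s ∘ φ, m := fun s => sch.m s ∘ φ } S₁ (tie_reindex r sch S₁ htie hφ) ⟨B, hφB⟩ hn

/-- **Contrapositive: an obstruction to D' forces divergent renormalisation.**  If the scheme is tied to `S₁` and the
subsequence form D' of CH_n FAILS at `(r, sch, n)`, `n > 0`, then `|c_k| → ∞`: the residual content of the stub lives on
schemes with divergent multiplicative renormalisation of the curvature species. [folklore] -/
theorem tendsto_abs_c_of_not_shieldedMomentBoundSubseq (r : LatticeRep G) (sch : SpeciesScheme (YMSpecies G))
    (S₁ : SchwingerFamily E4) (htie : Tie r sch S₁) {n : ℕ} (hn : 0 < n)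
    (h : ¬ ∃ φ : ℕ → ℕ, StrictMono φ ∧
      ∃ (C p : ℝ), 0 < C ∧ ∀ ρ : ℝ, 0 < ρ → ρ ≤ 1 → ∃ k₀ : ℕ, ∀ k : ℕ, k₀ ≤ k →
        ∀ y : Site 4, y ∈ box 4 (sch.L (φ k) / 2) →
          (∫ U, |((wilsonMeasure r.ρ (sch.β (φ k)) :
              Measure (GaugeConfig 4 (2 * sch.L (φ k) + 1) G))[(fun U =>
              sch.c r.curvature (φ k) *
                (r.curvature.F (configShift (-y) (torusLift (2 * sch.L (φ k) + 1) U)) -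
                  sch.m r.curvature (φ k))) |
              cylinderEvents {ℓ : Edge 4 (2 * sch.L (φ k) + 1) | ¬ ∀ ν : Fin 4,
                (ℓ.1 ν - ((y ν : ℤ) : ZMod (2 * sch.L (φ k) + 1)) +
                  ((⌊ρ / sch.a (φ k)⌋₊ : ℕ) : ZMod (2 * sch.L (φ k) + 1))).val ≤
                    2 * ⌊ρ / sch.a (φ k)⌋₊}]) U| ^ n
            ∂(wilsonMeasure r.ρ (sch.β (φ k)) : Measure (GaugeConfig 4 (2 * sch.L (φ k) + 1) G))) ^
              ((n : ℝ)⁻¹) ≤ C * ρ ^ (-p)) :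
    Tendsto (fun k => |sch.c r.curvature k|) atTop atTop := by
  refine tendsto_atTop.2 fun B => ?_
  by_contra hnot
  refine h (shieldedMomentBoundSubseq_of_frequently_bddRenormalisation r sch S₁ htie ⟨B, ?_⟩ hn)
  rw [not_eventually] at hnot
  exact hnot.mono fun k hk => le_of_lt (not_le.1 hk)

end Summit.QuantumFields.YangMills.Theorems.TemperedCurvatureMoments.Sketch

end
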